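import Literature.Geometry.Riemannian.GurskyViaclovskyOpennessProofs
import Literature.Analysis.FunctionSpaces.HolderManifoldLaplacian
import Literature.Analysis.FunctionSpaces.HolderManifoldLaplacianLocality
import Literature.Analysis.FunctionSpaces.HolderManifoldRegularity
import Literature.Analysis.FunctionSpaces.HolderChartRestriction
import HarnessLib

/-!
# Route EntropyRung · crux `ChangGurskyYang` · line `margerin-cone-hamilton-rails` — STUB O4
# `stub_backgroundScalarTendsto` (admissibility persists along a `C^{2,α}_𝔄`-continuous family)

Stub O4 of the registered skeleton `Cruxes/ChangGurskyYang/Lines/margerin-cone-hamilton-rails.lean`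
(reshape r17) of crux stmt-SmoothPoincare4-10834
(`Summit.SmoothPoincare4.SmoothPoincare4.Theses.EntropyRung.ChangGurskyYang`). In the openness step of
Gursky–Viaclovsky 2003, §5 ("`A^t_{u_t} ∈ Γ₂⁺` for `t` near `t₀`") the implicit function theorem gives
a family `t ↦ ψ_t` in `X = C^{2,α}_𝔄(M)` (`HolderManifoldFunction 𝔄 ℝ 2 α`), continuous at `t₀`; then
`backgroundScalar g (ψ t) = R_g − 6Δ_g(ψ t) − 6|d(ψ t)|²_g → backgroundScalar g (ψ t₀)` UNIFORMLY on
`M`. Chartwise (Gilbarg–Trudinger 2001, §6.1; the chart pieces `pᵢ = (ρᵢ w) ∘ chartᵢ⁻¹` of `w ∈ X`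
have `‖Dʲpᵢ‖_∞ ≤ ‖w‖_X`, `j ≤ 2`): `sup_M |Δ_g w| ≤ C‖w‖_X` (`exists_bound_dalembertian`, from the
tree's piecewise chart formula `dalembertian_eq_sum_piece`, the coefficients being bounded on the
compact sets `chartᵢ(tsupport ρᵢ)` off which the pieces vanish); `sup_M |g⁻¹(du, dv)| ≤ C‖u‖_X‖v‖_X`
(`exists_bound_innerDual`: at `x` pick `i` with `ρᵢ x ≠ 0`, write `g⁻¹(du, dv) = Ĝ^{ab}_i ∂_a û ∂_b v̂`
by `innerDual_mvfderiv_eq_sum_localFrame`, and control the first derivatives of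
`û = u ∘ chartᵢ⁻¹ = Σⱼ pⱼ ∘ (chartⱼ ∘ chartᵢ⁻¹)` by `‖u‖_X` and bounds for the transition maps on the
compact overlaps, `norm_fderiv_comp_symm_le`); linearity of `Δ_g` and of `d` then give
`sup_M |backgroundScalar g u − backgroundScalar g v| ≤ K(‖u − v‖ + ‖v‖‖u − v‖ + ‖u − v‖²) → 0`.
No hypothesis `α ≤ 1` is used (only sup bounds of chart derivatives). Everything is proved.

## References

* M. J. Gursky, J. A. Viaclovsky, *A fully nonlinear equation on four-manifolds with positive scalar
  curvature*, J. Differential Geom. 63 (2003) 131–154, §5 (proof of Thm. 1). [GurskyViaclovsky2003]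
* D. Gilbarg, N. S. Trudinger, *Elliptic Partial Differential Equations of Second Order* (2001),
  §6.1. [GilbargTrudinger2001]
-/

noncomputable section

-- every `Summit.SmoothPoincare4.SmoothPoincare4.…` name repeats the summit = sub-problem segment (D-0017 layout)
set_option linter.dupNamespace false

open Set Function Filter
open scoped Manifold ContDiff Topology NNReal
open Literature.Analysis.FunctionSpaces Literature.Geometry.Riemannian
  Literature.Geometry.Riemannian.GurskyViaclovskyPath Literature.Geometry.Lorentzian
  Literature.Geometry.Lorentzian.PseudoRiemannianMetric

namespace Summit.SmoothPoincare4.SmoothPoincare4.Theorems.MargerinRails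

namespace BackgroundScalarTendsto

/-- **Finitely many coefficient functions continuous on a chart target are uniformly bounded on the
compact set `chartᵢ(tsupport ρᵢ)`** (which lies in the target, `isCompact_image_tsupport`). [folklore] -/
theorem exists_forall_norm_le_of_continuousOn {ι : Type*} {E : Type*} [NormedAddCommGroup E]
    [NormedSpace ℝ E] {M : Type*} [TopologicalSpace M] [ChartedSpace E M] [CompactSpace M]
    (𝔄 : HolderChartData ι E M) (i : ι) {β : Type*} [Fintype β] (f : β → E → ℝ)
    (hf : ∀ b, ContinuousOn (f b) (𝔄.chart i).target) :
    ∃ C : ℝ, 0 ≤ C ∧ ∀ y ∈ 𝔄.chart i '' tsupport (𝔄.ρ i), ∀ b, ‖f b y‖ ≤ C := by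
  obtain ⟨hKc, hKt⟩ := 𝔄.isCompact_image_tsupport i
  have hc : ContinuousOn (fun y => ∑ b, ‖f b y‖) (𝔄.chart i).target :=
    continuousOn_finsetSum _ fun b _ => (hf b).norm
  obtain ⟨C, hC⟩ := hKc.exists_bound_of_continuousOn (hc.mono hKt)
  refine ⟨max C 0, le_max_right _ _, fun y hy b => ?_⟩
  have h := hC y hy
  rw [Real.norm_of_nonneg (Finset.sum_nonneg fun b _ => norm_nonneg _)] at h
  exact ((Finset.single_le_sum (f := fun b => ‖f b y‖) (fun b _ => norm_nonneg _)
    (Finset.mem_univ b)).trans h).trans (le_max_left _ _)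

/-- **First chart derivatives are controlled by the `C^{k,r}_𝔄` norm (`k ≥ 1`)**:
`‖D(w ∘ chartᵢ⁻¹)(chartᵢ x)‖ ≤ C‖w‖` for `w ∈ C^{k,r}_𝔄(M, F)`, all `i` and `x ∈ tsupport ρᵢ`. Near
`chartᵢ x`, `w ∘ chartᵢ⁻¹ = Σⱼ pⱼ ∘ (chartⱼ ∘ chartᵢ⁻¹)` over the `j` with `x ∈ tsupport ρⱼ` (chart pieces
`pⱼ`, `‖Dpⱼ‖_∞ ≤ ‖w‖`; the other summands vanish near `chartᵢ x`), and the derivatives of the smooth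
transition maps are bounded on the compact sets `chartᵢ(tsupport ρᵢ ∩ tsupport ρⱼ)`. [folklore] -/
theorem norm_fderiv_comp_symm_le {ι : Type*} [Fintype ι] {E : Type*} [NormedAddCommGroup E]
    [NormedSpace ℝ E] {M : Type*} [TopologicalSpace M] [ChartedSpace E M]
    [IsManifold 𝓘(ℝ, E) ∞ M] [CompactSpace M] (𝔄 : HolderChartData ι E M)
    {F : Type*} [NormedAddCommGroup F] [NormedSpace ℝ F] {k : ℕ} {r : ℝ≥0} (hk : k ≠ 0) :
    ∃ C : ℝ, 0 ≤ C ∧ ∀ (w : HolderManifoldFunction 𝔄 F k r) (i : ι) (x : M),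
      x ∈ tsupport (𝔄.ρ i) →
        ‖fderiv ℝ ((w : M → F) ∘ (𝔄.chart i).symm) (𝔄.chart i x)‖ ≤ C * ‖w‖ := by
  -- uniform bounds for the first derivatives of the transition maps on the compact overlaps
  have hT : ∀ i j : ι, ∃ T : ℝ, 0 ≤ T ∧ ∀ x ∈ tsupport (𝔄.ρ i) ∩ tsupport (𝔄.ρ j),
      ‖fderiv ℝ (𝔄.chart j ∘ (𝔄.chart i).symm) (𝔄.chart i x)‖ ≤ T := by
    intro i j
    have hKc : IsCompact (𝔄.chart i '' (tsupport (𝔄.ρ i) ∩ tsupport (𝔄.ρ j))) :=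
      (((isClosed_tsupport _).inter (isClosed_tsupport _)).isCompact).image_of_continuousOn
        ((𝔄.chart i).continuousOn.mono (inter_subset_left.trans (𝔄.isSubordinate i)))
    have hKU : 𝔄.chart i '' (tsupport (𝔄.ρ i) ∩ tsupport (𝔄.ρ j)) ⊆ 𝔄.transDomain i j := by
      rintro _ ⟨x, hx, rfl⟩
      refine ⟨(𝔄.chart i).map_source (𝔄.isSubordinate i hx.1), ?_⟩
      rw [mem_preimage, (𝔄.chart i).left_inv (𝔄.isSubordinate i hx.1)]
      exact 𝔄.isSubordinate j hx.2
    have hcont : ContinuousOn (fderiv ℝ (𝔄.chart j ∘ (𝔄.chart i).symm)) (𝔄.transDomain i j) :=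
      (𝔄.contDiffOn_trans i j).continuousOn_fderiv_of_isOpen (𝔄.isOpen_transDomain i j)
        (by exact_mod_cast le_top)
    obtain ⟨T, hT⟩ := hKc.exists_bound_of_continuousOn (hcont.mono hKU)
    exact ⟨max T 0, le_max_right _ _, fun x hx =>
      (hT _ (mem_image_of_mem _ hx)).trans (le_max_left _ _)⟩
  choose T hT0 hT using hT
  refine ⟨∑ i, ∑ j, T i j, Finset.sum_nonneg fun i _ => Finset.sum_nonneg fun j _ => hT0 i j, ?_⟩
  intro w i x hxi
  have hyt : 𝔄.chart i x ∈ (𝔄.chart i).target := (𝔄.chart i).map_source (𝔄.isSubordinate i hxi)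
  have hback : ∀ s : Set M, x ∈ s → 𝔄.chart i x ∈ (𝔄.chart i).symm ⁻¹' s := fun s hs => by
    rw [mem_preimage, (𝔄.chart i).left_inv (𝔄.isSubordinate i hxi)]
    exact hs
  -- each summand `z ↦ ρ_j (chart_i⁻¹ z) • w (chart_i⁻¹ z)` has a derivative of norm `≤ ‖w‖ T i j`
  have hsummand : ∀ j, ∃ D : E →L[ℝ] F,
      HasFDerivAt (fun z => 𝔄.ρ j ((𝔄.chart i).symm z) • w ((𝔄.chart i).symm z)) D
        (𝔄.chart i x) ∧ ‖D‖ ≤ ‖w‖ * T i j := by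
    intro j
    by_cases hxj : x ∈ tsupport (𝔄.ρ j)
    · have hyU : 𝔄.chart i x ∈ 𝔄.transDomain i j := ⟨hyt, hback _ (𝔄.isSubordinate j hxj)⟩
      have hev : (fun z => 𝔄.ρ j ((𝔄.chart i).symm z) • w ((𝔄.chart i).symm z))
          =ᶠ[𝓝 (𝔄.chart i x)] 𝔄.piece (w : M → F) j ∘ (𝔄.chart j ∘ (𝔄.chart i).symm) := by
        filter_upwards [(𝔄.isOpen_transDomain i j).mem_nhds hyU] with z hz
        exact 𝔄.smul_apply_eq_piece (w : M → F) hz.2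
      have hτ : DifferentiableAt ℝ (𝔄.chart j ∘ (𝔄.chart i).symm) (𝔄.chart i x) :=
        ((𝔄.contDiffOn_trans i j).differentiableOn (by simp)).differentiableAt
          ((𝔄.isOpen_transDomain i j).mem_nhds hyU)
      have hp : DifferentiableAt ℝ (𝔄.piece (w : M → F) j)
          ((𝔄.chart j ∘ (𝔄.chart i).symm) (𝔄.chart i x)) :=
        ((w.toPieces j).contDiff.differentiable (by exact_mod_cast hk)).differentiableAt
      refine ⟨_, (hp.hasFDerivAt.comp _ hτ.hasFDerivAt).congr_of_eventuallyEq hev, ?_⟩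
      refine (ContinuousLinearMap.opNorm_comp_le _ _).trans
        (mul_le_mul ?_ (hT i j x ⟨hxi, hxj⟩) (norm_nonneg _) (norm_nonneg _))
      rw [← norm_iteratedFDeriv_one]
      exact ((w.toPieces j).norm_iteratedFDeriv_le_norm (Nat.one_le_iff_ne_zero.mpr hk) _).trans
        (w.norm_toPieces_le j)
    · have hev : (fun z => 𝔄.ρ j ((𝔄.chart i).symm z) • w ((𝔄.chart i).symm z))
          =ᶠ[𝓝 (𝔄.chart i x)] fun _ => (0 : F) := by
        filter_upwards [((𝔄.chart i).continuousOn_symm.isOpen_inter_preimage (𝔄.chart i).open_target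
          (isClosed_tsupport (𝔄.ρ j)).isOpen_compl).mem_nhds ⟨hyt, hback _ hxj⟩] with z hz
        rw [image_eq_zero_of_notMem_tsupport hz.2, zero_smul]
      refine ⟨0, (hasFDerivAt_const (0 : F) _).congr_of_eventuallyEq hev, ?_⟩
      rw [norm_zero]
      exact mul_nonneg (norm_nonneg _) (hT0 i j)
  choose D hD hDle using hsummand
  have hsum : HasFDerivAt ((w : M → F) ∘ (𝔄.chart i).symm) (∑ j, D j) (𝔄.chart i x) := by
    have heq : ((w : M → F) ∘ (𝔄.chart i).symm) =
        fun z => ∑ j, 𝔄.ρ j ((𝔄.chart i).symm z) • w ((𝔄.chart i).symm z) :=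
      funext fun z => (𝔄.sum_smul_eq _ _).symm
    rw [heq]
    exact HasFDerivAt.fun_sum fun j _ => hD j
  rw [hsum.fderiv]
  calc ‖∑ j, D j‖ ≤ ∑ j, ‖w‖ * T i j := norm_sum_le_of_le _ fun j _ => hDle j
    _ = (∑ j, T i j) * ‖w‖ := by rw [← Finset.mul_sum, mul_comm]
    _ ≤ (∑ i, ∑ j, T i j) * ‖w‖ :=
        mul_le_mul_of_nonneg_right (Finset.single_le_sum (f := fun i => ∑ j, T i j)
          (fun i _ => Finset.sum_nonneg fun j _ => hT0 i j) (Finset.mem_univ i)) (norm_nonneg _)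

/-- **The `i`-th chart expression of `Δ_g` is controlled by the `C^{2,r}_𝔄` norm**: if `Ĝ^{ab}_i` and
`bˡ_i` are bounded by `G`, `B` on `chartᵢ(tsupport ρᵢ)`, then for `w ∈ C^{2,r}_𝔄(M)` and every `y`,
`|Σ_{ab} Ĝ^{ab}_i(y) D²pᵢ(y)(e_a, e_b) + Σ_l bˡ_i(y) Dpᵢ(y)(e_l)| ≤ (n²G(Σ‖e_a‖)² + nBΣ‖e_a‖)‖w‖`
(`pᵢ` the `i`-th chart piece: `‖Dʲpᵢ‖ ≤ ‖w‖`, and `pᵢ ≡ 0` off `chartᵢ(tsupport ρᵢ)`,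
`tsupport_piece_subset`). [cite: GilbargTrudinger2001, §6.1] -/
theorem norm_chartLaplacian_le {ι : Type*} [Fintype ι] {E : Type*} [NormedAddCommGroup E]
    [NormedSpace ℝ E] {M : Type*} [TopologicalSpace M] [ChartedSpace E M]
    [IsManifold 𝓘(ℝ, E) ∞ M] [CompactSpace M] (𝔄 : HolderChartData ι E M)
    (g : PseudoRiemannianMetric 𝓘(ℝ, E) ∞ E (TangentSpace 𝓘(ℝ, E) : M → Type _))
    {κ : Type*} [Fintype κ] [DecidableEq κ] (bE : Module.Basis κ ℝ E) (i : ι) {r : ℝ≥0} {G B : ℝ}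
    (hG0 : 0 ≤ G) (hB0 : 0 ≤ B)
    (hG : ∀ y ∈ 𝔄.chart i '' tsupport (𝔄.ρ i), ∀ a b, ‖gramInv bE g (𝔄.center i) y a b‖ ≤ G)
    (hB : ∀ y ∈ 𝔄.chart i '' tsupport (𝔄.ρ i), ∀ l, ‖firstOrderCoeff bE g (𝔄.center i) l y‖ ≤ B)
    (w : HolderManifoldFunction 𝔄 ℝ 2 r) (y : E) :
    ‖(∑ a, ∑ b, gramInv bE g (𝔄.center i) y a b *
        fderiv ℝ (fderiv ℝ (𝔄.piece (w : M → ℝ) i)) y (bE a) (bE b)) +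
      ∑ l, firstOrderCoeff bE g (𝔄.center i) l y * fderiv ℝ (𝔄.piece (w : M → ℝ) i) y (bE l)‖ ≤
      (Fintype.card κ * Fintype.card κ * G * (∑ a, ‖bE a‖) * (∑ a, ‖bE a‖) +
        Fintype.card κ * B * ∑ a, ‖bE a‖) * ‖w‖ := by
  set nb : ℝ := ∑ a, ‖bE a‖ with hnb
  have hnb0 : 0 ≤ nb := Finset.sum_nonneg fun a _ => norm_nonneg _
  have hba : ∀ a, ‖bE a‖ ≤ nb := fun a =>
    Finset.single_le_sum (f := fun a => ‖bE a‖) (fun a _ => norm_nonneg _) (Finset.mem_univ a)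
  -- sup bounds of the first two derivatives of the piece
  have hD1 : ∀ l, ‖fderiv ℝ (𝔄.piece (w : M → ℝ) i) y (bE l)‖ ≤ ‖w‖ * nb := fun l => by
    refine (ContinuousLinearMap.le_opNorm _ _).trans
      (mul_le_mul ?_ (hba l) (norm_nonneg _) (norm_nonneg _))
    rw [← norm_iteratedFDeriv_one]
    exact ((w.toPieces i).norm_iteratedFDeriv_le_norm (by norm_num) y).trans (w.norm_toPieces_le i)
  have hD2 : ∀ a b, ‖fderiv ℝ (fderiv ℝ (𝔄.piece (w : M → ℝ) i)) y (bE a) (bE b)‖ ≤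
      ‖w‖ * nb * nb := fun a b => by
    have h2 : ‖fderiv ℝ (fderiv ℝ (𝔄.piece (w : M → ℝ) i)) y‖ ≤ ‖w‖ := by
      rw [← norm_iteratedFDeriv_one, norm_iteratedFDeriv_fderiv]
      exact ((w.toPieces i).norm_iteratedFDeriv_le_norm le_rfl y).trans (w.norm_toPieces_le i)
    exact (ContinuousLinearMap.le_opNorm₂ _ _ _).trans (mul_le_mul
      (mul_le_mul h2 (hba a) (norm_nonneg _) (norm_nonneg _)) (hba b) (norm_nonneg _)
      (mul_nonneg (norm_nonneg _) hnb0))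
  -- the piece vanishes identically off `chart_i(tsupport ρ_i)`
  have hK : y ∉ 𝔄.chart i '' tsupport (𝔄.ρ i) → (∀ p, fderiv ℝ (𝔄.piece (w : M → ℝ) i) y p = 0) ∧
      ∀ p q, fderiv ℝ (fderiv ℝ (𝔄.piece (w : M → ℝ) i)) y p q = 0 := by
    intro hyK
    have hp0 : 𝔄.piece (w : M → ℝ) i =ᶠ[𝓝 y] fun _ => (0 : ℝ) :=
      notMem_tsupport_iff_eventuallyEq.1 fun h => hyK (𝔄.tsupport_piece_subset (w : M → ℝ) i h)
    have hd0 : fderiv ℝ (𝔄.piece (w : M → ℝ) i) =ᶠ[𝓝 y] fun _ => (0 : E →L[ℝ] ℝ) := by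
      have h := hp0.fderiv (𝕜 := ℝ)
      rw [fderiv_fun_const (𝕜 := ℝ) (E := E) (0 : ℝ)] at h
      exact h
    exact ⟨fun p => by rw [hd0.self_of_nhds]; rfl,
      fun p q => by rw [hd0.fderiv_eq, fderiv_const_apply (𝕜 := ℝ) (x := y)]; rfl⟩
  have hterm2 : ∀ a b, ‖gramInv bE g (𝔄.center i) y a b *
      fderiv ℝ (fderiv ℝ (𝔄.piece (w : M → ℝ) i)) y (bE a) (bE b)‖ ≤ G * (‖w‖ * nb * nb) := by
    intro a b
    by_cases hyK : y ∈ 𝔄.chart i '' tsupport (𝔄.ρ i)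
    · rw [norm_mul]
      exact mul_le_mul (hG y hyK a b) (hD2 a b) (norm_nonneg _) hG0
    · rw [(hK hyK).2, mul_zero, norm_zero]
      exact mul_nonneg hG0 (mul_nonneg (mul_nonneg (norm_nonneg _) hnb0) hnb0)
  have hterm1 : ∀ l, ‖firstOrderCoeff bE g (𝔄.center i) l y *
      fderiv ℝ (𝔄.piece (w : M → ℝ) i) y (bE l)‖ ≤ B * (‖w‖ * nb) := by
    intro l
    by_cases hyK : y ∈ 𝔄.chart i '' tsupport (𝔄.ρ i)
    · rw [norm_mul]
      exact mul_le_mul (hB y hyK l) (hD1 l) (norm_nonneg _) hB0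
    · rw [(hK hyK).1, mul_zero, norm_zero]
      exact mul_nonneg hB0 (mul_nonneg (norm_nonneg _) hnb0)
  refine (norm_add_le _ _).trans ?_
  refine (add_le_add (norm_sum_le_of_le _ fun a _ => norm_sum_le_of_le _ fun b _ => hterm2 a b)
    (norm_sum_le_of_le _ fun l _ => hterm1 l)).trans (le_of_eq ?_)
  simp only [Finset.sum_const, Finset.card_univ, nsmul_eq_mul]
  ring

/-- **`sup_M |Δ_g w| ≤ C ‖w‖_{C^{2,r}_𝔄}`** for a smooth pseudo-Riemannian metric on a compact manifold
with Hölder chart data `𝔄` (Gilbarg–Trudinger 2001, §6.1, through the piecewise chart formula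
`dalembertian_eq_sum_piece` and `norm_chartLaplacian_le`; the smooth coefficients `Ĝ^{ab}_i`, `bˡ_i`
are bounded on the compact sets `chartᵢ(tsupport ρᵢ)`). [cite: GilbargTrudinger2001, §6.1] -/
theorem exists_bound_dalembertian {ι : Type*} [Fintype ι] {E : Type} [NormedAddCommGroup E]
    [NormedSpace ℝ E] [FiniteDimensional ℝ E] {M : Type*} [TopologicalSpace M] [ChartedSpace E M]
    [IsManifold 𝓘(ℝ, E) ∞ M] [CompactSpace M] (𝔄 : HolderChartData ι E M)
    (g : PseudoRiemannianMetric 𝓘(ℝ, E) ∞ E (TangentSpace 𝓘(ℝ, E) : M → Type _))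
    [g.HasLeviCivita] {r : ℝ≥0} :
    ∃ C : ℝ, 0 ≤ C ∧ ∀ (w : HolderManifoldFunction 𝔄 ℝ 2 r) (x : M),
      |g.dalembertian w x| ≤ C * ‖w‖ := by
  classical
  obtain ⟨bE⟩ : Nonempty (Module.Basis (Fin (Module.finrank ℝ E)) ℝ E) := ⟨Module.finBasis ℝ E⟩
  choose G hG0 hG using fun i => exists_forall_norm_le_of_continuousOn 𝔄 i
    (fun (p : Fin (Module.finrank ℝ E) × Fin (Module.finrank ℝ E)) y =>
      gramInv bE g (𝔄.center i) y p.1 p.2)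
    fun p => (contDiffOn_gramInv bE g (𝔄.center i) p.1 p.2).continuousOn
  choose B hB0 hB using fun i => exists_forall_norm_le_of_continuousOn 𝔄 i
    (fun (l : Fin (Module.finrank ℝ E)) y => firstOrderCoeff bE g (𝔄.center i) l y)
    fun l => (contDiffOn_firstOrderCoeff bE g (𝔄.center i) l).continuousOn
  have hnb0 : 0 ≤ ∑ a, ‖bE a‖ := Finset.sum_nonneg fun a _ => norm_nonneg _
  refine ⟨∑ i, (Fintype.card (Fin (Module.finrank ℝ E)) * Fintype.card (Fin (Module.finrank ℝ E)) *
      G i * (∑ a, ‖bE a‖) * (∑ a, ‖bE a‖) + Fintype.card (Fin (Module.finrank ℝ E)) * B i *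
      ∑ a, ‖bE a‖), Finset.sum_nonneg fun i _ => ?_, fun w x => ?_⟩
  · have := hG0 i
    have := hB0 i
    positivity
  rw [dalembertian_eq_sum_piece 𝔄 bE g w.contMDiff x, ← Real.norm_eq_abs, Finset.sum_mul]
  exact norm_sum_le_of_le _ fun i _ => (norm_indicator_le_norm_self _ _).trans
    (norm_chartLaplacian_le 𝔄 g bE i (hG0 i) (hB0 i) (fun y hy a b => hG i y hy (a, b)) (hB i) w
      (𝔄.chart i x))

/-- **`sup_M |g⁻¹(du, dv)| ≤ C ‖u‖_{C^{2,r}_𝔄} ‖v‖_{C^{2,r}_𝔄}`** for a smooth pseudo-Riemannian metric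
on a compact manifold with Hölder chart data `𝔄`: at `x` choose `i` with `ρᵢ x ≠ 0`, so
`x ∈ tsupport ρᵢ ⊆ sourceᵢ`; there `g⁻¹(du, dv) = Σ_{ab} Ĝ^{ab}_i ∂_a û ∂_b v̂`
(`innerDual_mvfderiv_eq_sum_localFrame`, O'Neill 1983, Ch. 3, p. 60), with `Ĝ^{ab}_i` bounded on
`chartᵢ(tsupport ρᵢ)` and `‖Dû‖, ‖Dv̂‖` there bounded by `norm_fderiv_comp_symm_le`. [folklore] -/
theorem exists_bound_innerDual {ι : Type*} [Fintype ι] {E : Type} [NormedAddCommGroup E]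
    [NormedSpace ℝ E] [FiniteDimensional ℝ E] {M : Type*} [TopologicalSpace M] [ChartedSpace E M]
    [IsManifold 𝓘(ℝ, E) ∞ M] [CompactSpace M] (𝔄 : HolderChartData ι E M)
    (g : PseudoRiemannianMetric 𝓘(ℝ, E) ∞ E (TangentSpace 𝓘(ℝ, E) : M → Type _)) {r : ℝ≥0} :
    ∃ C : ℝ, 0 ≤ C ∧ ∀ (u v : HolderManifoldFunction 𝔄 ℝ 2 r) (x : M),
      |g.innerDual x (mvfderiv 𝓘(ℝ, E) (u : M → ℝ) x).toLinearMap
          (mvfderiv 𝓘(ℝ, E) (v : M → ℝ) x).toLinearMap| ≤ C * ‖u‖ * ‖v‖ := by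
  classical
  obtain ⟨bE⟩ : Nonempty (Module.Basis (Fin (Module.finrank ℝ E)) ℝ E) := ⟨Module.finBasis ℝ E⟩
  choose G hG0 hG using fun i => exists_forall_norm_le_of_continuousOn 𝔄 i
    (fun (p : Fin (Module.finrank ℝ E) × Fin (Module.finrank ℝ E)) y =>
      gramInv bE g (𝔄.center i) y p.1 p.2)
    fun p => (contDiffOn_gramInv bE g (𝔄.center i) p.1 p.2).continuousOn
  obtain ⟨C₂, hC₂0, hC₂⟩ := norm_fderiv_comp_symm_le 𝔄 (F := ℝ) (k := 2) (r := r) two_ne_zero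
  have hnb0 : 0 ≤ ∑ a, ‖bE a‖ := Finset.sum_nonneg fun a _ => norm_nonneg _
  have hba : ∀ a, ‖bE a‖ ≤ ∑ a, ‖bE a‖ := fun a =>
    Finset.single_le_sum (f := fun a => ‖bE a‖) (fun a _ => norm_nonneg _) (Finset.mem_univ a)
  have hGs0 : 0 ≤ ∑ i, G i := Finset.sum_nonneg fun i _ => hG0 i
  refine ⟨Fintype.card (Fin (Module.finrank ℝ E)) * Fintype.card (Fin (Module.finrank ℝ E)) *
      (∑ i, G i) * (C₂ * ∑ a, ‖bE a‖) * (C₂ * ∑ a, ‖bE a‖), by positivity, fun u v x => ?_⟩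
  -- a chart index with `ρ_i x ≠ 0`
  obtain ⟨i, -, hi⟩ := Finset.exists_ne_zero_of_sum_ne_zero (s := Finset.univ) (f := fun j => 𝔄.ρ j x)
    (by rw [← finsum_eq_sum_of_fintype, 𝔄.ρ.sum_eq_one (mem_univ x)]; exact one_ne_zero)
  have hxT : x ∈ tsupport (𝔄.ρ i) := subset_closure (mem_support.2 hi)
  have hxs : x ∈ (𝔄.chart i).source := 𝔄.isSubordinate i hxT
  have hps : x ∈ (extChartAt 𝓘(ℝ, E) (𝔄.center i)).source := by
    simpa only [extChartAt_source] using hxs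
  have h1 : extChartAt 𝓘(ℝ, E) (𝔄.center i) x = 𝔄.chart i x := by simp
  have hd : ∀ w : HolderManifoldFunction 𝔄 ℝ 2 r,
      MDifferentiableAt 𝓘(ℝ, E) 𝓘(ℝ, ℝ) (w : M → ℝ) x := fun w =>
    (w.contMDiff x).mdifferentiableAt (by norm_num)
  have hrep : ∀ w : HolderManifoldFunction 𝔄 ℝ 2 r, ((w : M → ℝ) ∘ (𝔄.chart i).symm)
      =ᶠ[𝓝 (extChartAt 𝓘(ℝ, E) (𝔄.center i) x)] (w : M → ℝ) ∘ (extChartAt 𝓘(ℝ, E) (𝔄.center i)).symm :=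
    fun w => EventuallyEq.of_eq (funext fun y => by simp)
  have hder : ∀ (w : HolderManifoldFunction 𝔄 ℝ 2 r) (a : Fin (Module.finrank ℝ E)),
      ‖fderiv ℝ ((w : M → ℝ) ∘ (𝔄.chart i).symm) (𝔄.chart i x) (bE a)‖ ≤
        C₂ * (∑ a, ‖bE a‖) * ‖w‖ := fun w a =>
    calc ‖fderiv ℝ ((w : M → ℝ) ∘ (𝔄.chart i).symm) (𝔄.chart i x) (bE a)‖
        ≤ ‖fderiv ℝ ((w : M → ℝ) ∘ (𝔄.chart i).symm) (𝔄.chart i x)‖ * ‖bE a‖ :=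
          ContinuousLinearMap.le_opNorm _ _
      _ ≤ C₂ * ‖w‖ * ∑ a, ‖bE a‖ :=
          mul_le_mul (hC₂ w i x hxT) (hba a) (norm_nonneg _) (mul_nonneg hC₂0 (norm_nonneg _))
      _ = C₂ * (∑ a, ‖bE a‖) * ‖w‖ := by ring
  have hmat : (Matrix.of fun a b => g.val x
      ((trivializationAt E (TangentSpace 𝓘(ℝ, E)) (𝔄.center i)).localFrame bE a x)
      ((trivializationAt E (TangentSpace 𝓘(ℝ, E)) (𝔄.center i)).localFrame bE b x)) =
      Matrix.of (gram bE g (𝔄.center i) (extChartAt 𝓘(ℝ, E) (𝔄.center i) x)) := by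
    ext a b
    simp only [Matrix.of_apply, gram]
    rw [(extChartAt 𝓘(ℝ, E) (𝔄.center i)).left_inv hps]
  have hterm : ∀ a b, ‖(Matrix.of fun a b => g.val x
      ((trivializationAt E (TangentSpace 𝓘(ℝ, E)) (𝔄.center i)).localFrame bE a x)
      ((trivializationAt E (TangentSpace 𝓘(ℝ, E)) (𝔄.center i)).localFrame bE b x))⁻¹ a b *
      fderiv ℝ ((u : M → ℝ) ∘ (𝔄.chart i).symm) (𝔄.chart i x) (bE a) *
      fderiv ℝ ((v : M → ℝ) ∘ (𝔄.chart i).symm) (𝔄.chart i x) (bE b)‖ ≤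
      (∑ i, G i) * (C₂ * (∑ a, ‖bE a‖) * ‖u‖) * (C₂ * (∑ a, ‖bE a‖) * ‖v‖) := fun a b => by
    have hcoef := (hG i (𝔄.chart i x) (mem_image_of_mem _ hxT) (a, b)).trans
      (Finset.single_le_sum (f := G) (fun i _ => hG0 i) (Finset.mem_univ i))
    rw [← h1] at hcoef
    rw [norm_mul, norm_mul, hmat]
    exact mul_le_mul (mul_le_mul hcoef (hder u a) (norm_nonneg _) hGs0) (hder v b)
      (norm_nonneg _) (mul_nonneg hGs0 (by positivity))
  rw [innerDual_mvfderiv_eq_sum_localFrame g bE hxs (hd u) (hd v) (hrep u) (hrep v), h1,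
    ← Real.norm_eq_abs]
  calc _ ≤ ∑ a : Fin (Module.finrank ℝ E), ∑ b : Fin (Module.finrank ℝ E),
        (∑ i, G i) * (C₂ * (∑ a, ‖bE a‖) * ‖u‖) * (C₂ * (∑ a, ‖bE a‖) * ‖v‖) :=
        norm_sum_le_of_le _ fun a _ => norm_sum_le_of_le _ fun b _ => hterm a b
    _ = _ := by
        simp only [Finset.sum_const, Finset.card_univ, nsmul_eq_mul]
        ring

end BackgroundScalarTendsto

open BackgroundScalarTendsto in
/-- **STUB O4 — ADMISSIBILITY PERSISTS: `X`-convergence ⇒ uniform convergence of `backgroundScalar`**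
(the step "`A^t_{u_t} ∈ Γ₂⁺` for `t` near `t₀`" of Gursky–Viaclovsky 2003, §5, in the tree's vocabulary
`R_{h_t} > 0`): if `ψ t → W₀` in `X = C^{2,α}_𝔄(M)` as `t → t₀`, then
`backgroundScalar g (ψ t) = R_g − 6Δ_g(ψ t) − 6|d(ψ t)|²_g → backgroundScalar g W₀` uniformly on `M`:
`sup_M |Δ_g w| ≤ C₁‖w‖_X` (`exists_bound_dalembertian`), `sup_M |g⁻¹(du, dv)| ≤ C₂‖u‖_X‖v‖_X`
(`exists_bound_innerDual`), and linearity give `sup_M |backgroundScalar g (ψ t) − backgroundScalar g W₀|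
≤ 6C₁‖ψ t − W₀‖ + 6(2C₂‖W₀‖‖ψ t − W₀‖ + C₂‖ψ t − W₀‖²) → 0`.
[cite: GurskyViaclovsky2003, §5 (proof of Thm. 1)] -/
theorem stub_backgroundScalarTendsto :
    ∀ (M : Type) [TopologicalSpace M] [T2Space M] [ChartedSpace (EuclideanSpace ℝ (Fin 4)) M]
      [IsManifold (𝓡 4) ∞ M] [CompactSpace M] {ι : Type} [Fintype ι]
      (𝔄 : HolderChartData ι (EuclideanSpace ℝ (Fin 4)) M)
      (g : PseudoRiemannianMetric (𝓡 4) ∞ (EuclideanSpace ℝ (Fin 4)) (TangentSpace (𝓡 4) : M → Type _))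
      [g.HasLeviCivita] {α : ℝ≥0} (ψ : ℝ → HolderManifoldFunction 𝔄 ℝ 2 α)
      (W₀ : HolderManifoldFunction 𝔄 ℝ 2 α) (t₀ : ℝ), Tendsto ψ (𝓝 t₀) (𝓝 W₀) →
      TendstoUniformly (fun t x => backgroundScalar g (ψ t) x) (fun x => backgroundScalar g W₀ x) (𝓝 t₀) := by
  intro M _ _ _ _ _ ι _ 𝔄 g _ α ψ W₀ t₀ hψ
  obtain ⟨C₁, -, hC₁⟩ := exists_bound_dalembertian 𝔄 g (r := α)
  obtain ⟨C₂, -, hC₂⟩ := exists_bound_innerDual 𝔄 g (r := α)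
  -- the pointwise estimate
  have hbound : ∀ (u v : HolderManifoldFunction 𝔄 ℝ 2 α) (x : M),
      dist (backgroundScalar g v x) (backgroundScalar g u x) ≤
        6 * (C₁ * ‖u - v‖) + 6 * (2 * (C₂ * ‖v‖ * ‖u - v‖) + C₂ * ‖u - v‖ * ‖u - v‖) := by
    intro u v x
    have hv2 : ContMDiffAt (𝓡 4) 𝓘(ℝ, ℝ) 2 (v : M → ℝ) x := v.contMDiff.contMDiffAt
    have hw2 : ContMDiffAt (𝓡 4) 𝓘(ℝ, ℝ) 2 ((u - v : HolderManifoldFunction 𝔄 ℝ 2 α) : M → ℝ) x :=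
      (u - v).contMDiff.contMDiffAt
    have hfun : (u : M → ℝ) = fun y => v y + 1 * (u - v : HolderManifoldFunction 𝔄 ℝ 2 α) y := by
      funext y
      simp only [HolderManifoldFunction.coe_sub, Pi.sub_apply]
      ring
    have h1 := hC₁ (u - v) x
    have h2 := hC₂ v (u - v) x
    have h3 : |g.gradSq (u - v : HolderManifoldFunction 𝔄 ℝ 2 α) x| ≤ C₂ * ‖u - v‖ * ‖u - v‖ :=
      hC₂ (u - v) (u - v) x
    simp only [Real.dist_eq, backgroundScalar]
    rw [hfun, g.dalembertian_add_const_mul_of_contMDiffAt hv2 hw2 1,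
      g.gradSq_add_const_mul (hv2.mdifferentiableAt (by norm_num))
        (hw2.mdifferentiableAt (by norm_num)) 1]
    set Δw := g.dalembertian ((u - v : HolderManifoldFunction 𝔄 ℝ 2 α) : M → ℝ) x
    set I := g.innerDual x (mvfderiv (𝓡 4) (v : M → ℝ) x).toLinearMap
      (mvfderiv (𝓡 4) ((u - v : HolderManifoldFunction 𝔄 ℝ 2 α) : M → ℝ) x).toLinearMap
    set Gw := g.gradSq ((u - v : HolderManifoldFunction 𝔄 ℝ 2 α) : M → ℝ) x
    have e : g.scalarCurvature x - 6 * g.dalembertian v x - 6 * g.gradSq v x -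
        (g.scalarCurvature x - 6 * (g.dalembertian v x + 1 * Δw) -
          6 * (g.gradSq v x + 2 * 1 * I + 1 ^ 2 * Gw)) = 6 * Δw + 6 * (2 * I + Gw) := by
      ring
    obtain ⟨⟨h1a, h1b⟩, ⟨h2a, h2b⟩, h3a, h3b⟩ :=
      And.intro (abs_le.1 h1) (And.intro (abs_le.1 h2) (abs_le.1 h3))
    rw [e, abs_le]
    constructor <;> linarith
  -- the right-hand side tends to `0` as `t → t₀`
  have h0 : Tendsto (fun t => ‖ψ t - W₀‖) (𝓝 t₀) (𝓝 0) := tendsto_iff_norm_sub_tendsto_zero.1 hψ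
  have hlim : Tendsto (fun t => 6 * (C₁ * ‖ψ t - W₀‖) +
      6 * (2 * (C₂ * ‖W₀‖ * ‖ψ t - W₀‖) + C₂ * ‖ψ t - W₀‖ * ‖ψ t - W₀‖)) (𝓝 t₀) (𝓝 0) := by
    have hc : Continuous fun d : ℝ => 6 * (C₁ * d) + 6 * (2 * (C₂ * ‖W₀‖ * d) + C₂ * d * d) := by
      fun_prop
    have h := (hc.tendsto 0).comp h0
    simp only [mul_zero, add_zero] at h
    exact h
  refine Metric.tendstoUniformly_iff.2 fun ε hε => ?_
  filter_upwards [(tendsto_order.1 hlim).2 ε hε] with t ht x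
  exact (hbound (ψ t) W₀ x).trans_lt ht

end Summit.SmoothPoincare4.SmoothPoincare4.Theorems.MargerinRails

end
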